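import Mathlib
import HarnessLib
import Summits.HubbardSuperconductivity.HubbardSuperconductivity.Theorems.KLProgrammeKLRegimeSplitPhValueExchangeData
import Summits.HubbardSuperconductivity.HubbardSuperconductivity.Theorems.KLProgrammeKLRegimeSplitEdgeFactsBandJets

/-!
# Route `KLProgramme` — ENGINE (stmt-HubbardSuperconductivity-20437 `KLRegimeEngineV17F2`), row (c) binder #8 (★ v19 `hexLadMV`), the DIRECT p-h value row `RP` OFF THE DIAGONAL:
# momentum-TRANSFER shifts `k̃ ↦ k̃ ± q` (`q = x − y`) — resolvent identity, shell data, and the abstract «diagonal object + one-more-rung correction» decomposition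
# (cell gate-hubbard-kl, seat hubbard-kl-k3c2-p2 g32, technique «thermal-bar induction n ≤ nScales β + 1 with EngineBoundsAtV4S sums»; brick O6k-a, the momentum twin of O6h-a/O6h-c)

WHY.  The rows door `klmd_defect_le_rows_family` wants `hP` at EVERY pinned pair `(x, y) ∈ klBall²`, not only at the diagonal `y = x` where O6f/O6f′ live: after O6f
`klph_directRow_eq` the partner label is `p′ = (p.1, p.2 + x − y)` — the SAME Matsubara index and the momentum moved by the transfer `q := x − y`.  Exactly as O6h treated the
exchange row's thermal FREQUENCY shift, the first bubble ordering is re-indexed onto the hard line's label (here by the torus translation `k̃ ↦ k̃ + q`, a bijection — no boundary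
labels), so that `RP(x,y) = Σ_pΣ_σ (Ẇ_tβL²ĝ)(p)(Φ_jβL²ĝ)(p)·[F (p⁻) σ p + F p σ (p⁺)]` (the DIAGONAL object of O6e″/O6i-c with the two partner values, `p^± = (p.1, p.2 ± q)`) `+` a correction
carrying `(Φ_jβL²ĝ)(p^±) − (Φ_jβL²ĝ)(p)`, which is LINEAR in the band shift `d_q := sup_k |e_K(k̃ ± q) − e_K(k̃)| ≤ (4 + ‖K‖₁)·‖q‖_𝕋` (`klbj_abs_nambuXiCT_add_sub_le`): the
«Lindhard value, linear decay below resolution» of E1-LEDGER line #8 (located #23's plateau words) on the closer side.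

§1 `klph_propCT_msub`, `klph_norm_propCT_msub_le` — `ĝ(ν,k̃′) − ĝ(ν,k̃) = (e_K(k̃) − e_K(k̃′))·ĝ(ν,k̃)ĝ(ν,k̃′)`, `‖…‖ ≤ |e_K(k̃′) − e_K(k̃)|·‖ĝ(ν,k̃)‖‖ĝ(ν,k̃′)‖`.
§2 shell data (momentum twins of O6h-c): `klph_mshift_sq_ge_of_shell` (`Ẇ_Λ(p) ≠ 0`, `|e′ − e_p| ≤ d`, `8d ≤ Λ` ⇒ `Λ²/16 ≤ ω_p² + e′²`), `klph_norm_propCT_mshift_le`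
   (`‖ĝ(ν_p, k̃′)‖ ≤ 4/Λ`), `klph_memberSymbol_mshift_le` (`|Φ_j(t)(ν_p, k̃′) − Φ_j(t)(p)| ≤ (128/Λ²)·d·(2Λ + d)`), `klph_bandShift_le` (`d = (4 + ‖K‖₁)‖q‖_𝕋` both ways).
§3 `klph_transfer_decomp_abstract` — for any `hard soft : FreqMomentum → ℂ`, `W : FreqMomentum → Fin 2 → FreqMomentum → ℂ`, `q`:
   `Σ_pΣ_σ (soft p·hard p⁺ + hard p·soft p⁺)·W p σ p⁺ = Σ_pΣ_σ hard p·soft p·(W p⁻ σ p + W p σ p⁺) + Σ_pΣ_σ hard p·((soft p⁻ − soft p)·W p⁻ σ p + (soft p⁺ − soft p)·W p σ p⁺)`;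
   `klph_shift_corr_abstract_le` — the correction is `≤ #{hard ≠ 0}·2·H·(2E·F∞)` for ANY pair of shift maps (sup data `H`, `E`, `F∞` on the hard support).
Pure algebra / calculus over landed rows; no definitions; nothing asserts (c), K3 or superconductivity.  [cite: BenfattoGiulianiMastropietro2006, §2.4–§2.5]
-/

noncomputable section

namespace Summit.HubbardSuperconductivity.HubbardSuperconductivity.Theorems.KLRegimeSplit

set_option linter.dupNamespace false -- summit = problem name (single-conjunct summit), D-0017

open Real Set Finset Literature.MathematicalPhysics.QuantumLattice
open Literature.Probability.LatticeModels hiding torusSupNorm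
open Literature.MathematicalPhysics.QuantumLattice.BandSectorCounting
open Summit.HubbardSuperconductivity.HubbardSuperconductivity.Theorems.TwoPointAssembly
open Summit.HubbardSuperconductivity.HubbardSuperconductivity.Theorems.KLProgrammeLegKernels
open Summit.HubbardSuperconductivity.HubbardSuperconductivity.Theorems.KLRegimeWick
open Summit.HubbardSuperconductivity.HubbardSuperconductivity.Theorems.EngineV8
open Summit.HubbardSuperconductivity.HubbardSuperconductivity.Theorems.DispersionFlow
open Summit.HubbardSuperconductivity.HubbardSuperconductivity.Theorems.PerturbedFermiCurve

variable {L M : ℕ} [NeZero L] [NeZero M]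

/-! ## §1 The resolvent identity in the momentum variable -/

section Resolvent

variable {β : ℝ} (μ : ℝ) (K : TrigPolyC4v)

omit [NeZero L] [NeZero M] in
/-- **Resolvent identity, momentum**: `ĝ(ν,k̃′) − ĝ(ν,k̃) = (e_K(k̃) − e_K(k̃′))·ĝ(ν,k̃)·ĝ(ν,k̃′)` (`β ≠ 0`). -/
theorem klph_propCT_msub (hβ : β ≠ 0) (ν : MatsubaraIdx M) (k k' : TorusSite 2 L) :
    propCT L M β μ K (ν, k') - propCT L M β μ K (ν, k) =
      ((nambuXiCT L μ K k : ℂ) - (nambuXiCT L μ K k' : ℂ)) * propCT L M β μ K (ν, k) * propCT L M β μ K (ν, k') := by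
  obtain ⟨h1, h10⟩ := propCT_eq_one_div μ K hβ ((ν, k) : FreqMomentum L M)
  obtain ⟨h2, h20⟩ := propCT_eq_one_div μ K hβ ((ν, k') : FreqMomentum L M)
  simp only at h1 h2 h10 h20
  set a : ℂ := -Complex.I * (matsubaraFreq β M ν : ℂ) + (nambuXiCT L μ K k : ℂ) with ha
  set a' : ℂ := -Complex.I * (matsubaraFreq β M ν : ℂ) + (nambuXiCT L μ K k' : ℂ) with ha'
  have hdiff : a - a' = (nambuXiCT L μ K k : ℂ) - (nambuXiCT L μ K k' : ℂ) := by rw [ha, ha']; ring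
  rw [h1, h2, one_div, one_div, inv_sub_inv h20 h10, hdiff, div_eq_mul_inv, mul_inv, mul_assoc]
  ring

omit [NeZero L] [NeZero M] in
/-- **`‖ĝ(ν,k̃′) − ĝ(ν,k̃)‖ ≤ |e_K(k̃′) − e_K(k̃)|·‖ĝ(ν,k̃)‖·‖ĝ(ν,k̃′)‖.** -/
theorem klph_norm_propCT_msub_le (hβ : β ≠ 0) (ν : MatsubaraIdx M) (k k' : TorusSite 2 L) :
    ‖propCT L M β μ K (ν, k') - propCT L M β μ K (ν, k)‖ ≤
      |nambuXiCT L μ K k' - nambuXiCT L μ K k| * ‖propCT L M β μ K (ν, k)‖ * ‖propCT L M β μ K (ν, k')‖ := by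
  rw [klph_propCT_msub μ K hβ ν k k', norm_mul, norm_mul, ← Complex.ofReal_sub, Complex.norm_real, Real.norm_eq_abs, abs_sub_comm]

end Resolvent

/-! ## §2 Shell data under a momentum shift -/

section Shell

omit [NeZero L] [NeZero M] in
/-- **The shifted momentum stays on a comparable shell**: `Ẇ_Λ(p) ≠ 0`, `|e′ − e_p| ≤ d`, `8d ≤ Λ` ⇒ `Λ²/16 ≤ ω_p² + e′²`. -/
theorem klph_mshift_sq_ge_of_shell (β μ : ℝ) (K : TrigPolyC4v) {Λ : ℝ} (hΛ : 0 < Λ) {p : FreqMomentum L M}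
    (hp : deriv (fun Λ' : ℝ => hubbardCutoffWeightCT L M β μ K Λ' p) Λ ≠ 0) {e' d : ℝ} (hq : |e' - nambuXiCT L μ K p.2| ≤ d) (h8 : 8 * d ≤ Λ) :
    Λ ^ 2 / 16 ≤ matsubaraFreq β M p.1 ^ 2 + e' ^ 2 := by
  obtain ⟨hlo, -⟩ := klph_shell_of_derivWeight_ne_zero β μ K hΛ.ne' hp
  set ω := matsubaraFreq β M p.1
  set e := nambuXiCT L μ K p.2
  by_cases hω : Λ ^ 2 / 16 ≤ ω ^ 2
  · nlinarith [sq_nonneg e']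
  · push Not at hω
    have he2 : 3 * Λ ^ 2 / 16 ≤ e ^ 2 := by linarith
    have heabs : 2 * Λ / 5 ≤ |e| := by
      by_contra h
      push Not at h
      have h0 : 0 ≤ |e| := abs_nonneg _
      have : |e| ^ 2 < (2 * Λ / 5) ^ 2 := by exact pow_lt_pow_left₀ h h0 two_ne_zero
      rw [sq_abs] at this
      nlinarith
    have he'abs : Λ / 4 ≤ |e'| := by
      have h1 : |e| - |e' - e| ≤ |e'| := by
        have := abs_sub_abs_le_abs_sub e e'
        rw [abs_sub_comm] at this
        linarith
      linarith
    have : (Λ / 4) ^ 2 ≤ e' ^ 2 := by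
      rw [← sq_abs e']
      exact pow_le_pow_left₀ (by positivity) he'abs 2
    nlinarith [sq_nonneg ω]

omit [NeZero L] [NeZero M] in
/-- **The momentum-shifted rung on the hard shell**: `Ẇ_Λ(p) ≠ 0`, `|e_K(k̃′) − e_K(k̃_p)| ≤ d`, `8d ≤ Λ` ⇒ `‖ĝ_K(ν_p, k̃′)‖ ≤ 4/Λ`. -/
theorem klph_norm_propCT_mshift_le (β μ : ℝ) (K : TrigPolyC4v) {Λ : ℝ} (hΛ : 0 < Λ) {p : FreqMomentum L M}
    (hp : deriv (fun Λ' : ℝ => hubbardCutoffWeightCT L M β μ K Λ' p) Λ ≠ 0) {k' : TorusSite 2 L} {d : ℝ}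
    (hq : |nambuXiCT L μ K k' - nambuXiCT L μ K p.2| ≤ d) (h8 : 8 * d ≤ Λ) :
    ‖propCT L M β μ K (p.1, k')‖ ≤ 4 / Λ := by
  have hs := klph_mshift_sq_ge_of_shell β μ K hΛ hp hq h8
  rw [norm_propCT_eq]
  have hsqrt : Λ / 4 ≤ Real.sqrt (matsubaraFreq β M p.1 ^ 2 + nambuXiCT L μ K k' ^ 2) := by
    rw [show Λ / 4 = Real.sqrt ((Λ / 4) ^ 2) from (Real.sqrt_sq (by positivity)).symm]
    exact Real.sqrt_le_sqrt (by linarith)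
  calc (Real.sqrt (matsubaraFreq β M p.1 ^ 2 + nambuXiCT L μ K k' ^ 2))⁻¹ ≤ (Λ / 4)⁻¹ := inv_anti₀ (by positivity) hsqrt
    _ = 4 / Λ := by rw [inv_div]

omit [NeZero L] [NeZero M] in
/-- **The member symbol under the momentum shift**: for the STEP's member symbol `Φ_j(t) = klPhi Λ_j Λ(t)(ω² + e²)` (`0 < Λ_j ≤ Λ(t)`), on the hard shell at `Λ(t)` with
`|e_K(k̃′) − e_K(k̃_p)| ≤ d`, `0 ≤ d`, `8d ≤ Λ(t)`: `|Φ_j(t)(ν_p, k̃′) − Φ_j(t)(p)| ≤ (128/Λ(t)²)·(d·(2Λ(t) + d))`. -/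
theorem klph_memberSymbol_mshift_le (β μ : ℝ) (K : TrigPolyC4v) (n j : ℕ) {Λ : ℝ} (hΛj : 0 < klScale klE0 j) (hle : klScale klE0 j ≤ Λ)
    {p : FreqMomentum L M} (hp : deriv (fun Λ' : ℝ => hubbardCutoffWeightCT L M β μ K Λ' p) Λ ≠ 0) {k' : TorusSite 2 L} {d : ℝ} (hd : 0 ≤ d)
    (hq : |nambuXiCT L μ K k' - nambuXiCT L μ K p.2| ≤ d) (h8 : 8 * d ≤ Λ) :
    |(softSymbolCompl L M β μ K (n + 1) j (p.1, k') +
          (hubbardCutoffWeightCT L M β μ K (klScale klE0 (n + 1)) (p.1, k') - hubbardCutoffWeightCT L M β μ K Λ (p.1, k'))) -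
        (softSymbolCompl L M β μ K (n + 1) j p + (hubbardCutoffWeightCT L M β μ K (klScale klE0 (n + 1)) p - hubbardCutoffWeightCT L M β μ K Λ p))| ≤
      128 / Λ ^ 2 * (d * (2 * Λ + d)) := by
  have hΛ : 0 < Λ := hΛj.trans_le hle
  rw [klfw_memberSymbol_eq β μ K n j Λ (p.1, k'), klfw_memberSymbol_eq β μ K n j Λ p]
  obtain ⟨hlo, hhi⟩ := klph_shell_of_derivWeight_ne_zero β μ K hΛ.ne' hp
  have hs' := klph_mshift_sq_ge_of_shell β μ K hΛ hp hq h8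
  have h := klph_klPhi_local_lipschitz hΛj hle hlo hs'
  refine h.trans (mul_le_mul_of_nonneg_left ?_ (by positivity))
  set e := nambuXiCT L μ K p.2
  set e' := nambuXiCT L μ K k'
  set ω := matsubaraFreq β M p.1
  have heΛ : |e| ≤ Λ := by
    rw [← Real.sqrt_sq hΛ.le, ← Real.sqrt_sq_eq_abs]
    exact Real.sqrt_le_sqrt (by nlinarith [sq_nonneg ω])
  have hsum : |e' + e| ≤ 2 * Λ + d := by
    calc |e' + e| = |(e' - e) + 2 * e| := by ring_nf
      _ ≤ |e' - e| + |2 * e| := abs_add_le _ _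
      _ ≤ d + 2 * Λ := by rw [abs_mul, abs_two]; linarith
      _ = 2 * Λ + d := by ring
  calc |ω ^ 2 + e' ^ 2 - (ω ^ 2 + e ^ 2)| = |e' - e| * |e' + e| := by
        rw [← abs_mul]; congr 1; ring
    _ ≤ d * (2 * Λ + d) := mul_le_mul hq hsum (abs_nonneg _) hd

omit [NeZero M] in
/-- **The band shift of a momentum transfer** (both directions): `|e_K(k̃ + q) − e_K(k̃)| ≤ (4 + ‖K‖₁)·‖q‖_𝕋` and `|e_K(k̃ − q) − e_K(k̃)| ≤ (4 + ‖K‖₁)·‖q‖_𝕋`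
(`klbj_abs_nambuXiCT_add_sub_le` / `klbj_abs_nambuXiCT_sub_sub_le`). -/
theorem klph_bandShift_le (μ : ℝ) (K : TrigPolyC4v) (k q : TorusSite 2 L) :
    |nambuXiCT L μ K (k + q) - nambuXiCT L μ K k| ≤ (4 + K.coeffNorm 1) * klTorusNorm L q ∧
      |nambuXiCT L μ K (k - q) - nambuXiCT L μ K k| ≤ (4 + K.coeffNorm 1) * klTorusNorm L q :=
  ⟨klbj_abs_nambuXiCT_add_sub_le μ K k q, klbj_abs_nambuXiCT_sub_sub_le μ K k q⟩

end Shell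

/-! ## §3 Reindexing the first bubble ordering by the torus translation, and the abstract decomposition -/

section Transfer

variable (q : TorusSite 2 L)

omit [NeZero M] in
/-- **Reindexing by the momentum translation** (a bijection of the label set): `Σ_p g p p⁺ = Σ_p g p⁻ p` (`p^± = (p.1, p.2 ± q)`). -/
theorem klph_sum_mshift_reindex (g : FreqMomentum L M → FreqMomentum L M → ℂ) :
    (∑ p : FreqMomentum L M, g p (p.1, p.2 + q)) = ∑ p : FreqMomentum L M, g (p.1, p.2 - q) p := by
  let e : FreqMomentum L M ≃ FreqMomentum L M :=
    ⟨fun p => (p.1, p.2 + q), fun p => (p.1, p.2 - q), fun p => by simp, fun p => by simp⟩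
  refine Fintype.sum_equiv e _ _ fun p => ?_
  simp only [e, Equiv.coe_fn_mk, add_sub_cancel_right, Prod.mk.eta]

omit [NeZero M] in
/-- **ABSTRACT DECOMPOSITION OF THE DIRECT ROW AT TRANSFER `q`.**  For any `hard soft : FreqMomentum → ℂ`, `W : FreqMomentum → Fin 2 → FreqMomentum → ℂ`:
`Σ_pΣ_σ (soft p·hard p⁺ + hard p·soft p⁺)·W p σ p⁺ = Σ_pΣ_σ hard p·soft p·(W p⁻ σ p + W p σ p⁺) + Σ_pΣ_σ hard p·((soft p⁻ − soft p)·W p⁻ σ p + (soft p⁺ − soft p)·W p σ p⁺)`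
— the diagonal (rotation + moduli) object with the two partner values plus the one-more-rung correction. -/
theorem klph_transfer_decomp_abstract (hard soft : FreqMomentum L M → ℂ) (W : FreqMomentum L M → Fin 2 → FreqMomentum L M → ℂ) :
    (∑ p : FreqMomentum L M, ∑ σ : Fin 2, (soft p * hard (p.1, p.2 + q) + hard p * soft (p.1, p.2 + q)) * W p σ (p.1, p.2 + q)) =
      (∑ p : FreqMomentum L M, ∑ σ : Fin 2, hard p * soft p * (W (p.1, p.2 - q) σ p + W p σ (p.1, p.2 + q))) +
        ∑ p : FreqMomentum L M, ∑ σ : Fin 2,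
          hard p * ((soft (p.1, p.2 - q) - soft p) * W (p.1, p.2 - q) σ p + (soft (p.1, p.2 + q) - soft p) * W p σ (p.1, p.2 + q)) := by
  -- split the two orderings
  have hsplit : (∑ p : FreqMomentum L M, ∑ σ : Fin 2, (soft p * hard (p.1, p.2 + q) + hard p * soft (p.1, p.2 + q)) * W p σ (p.1, p.2 + q)) =
      (∑ p : FreqMomentum L M, ∑ σ : Fin 2, soft p * hard (p.1, p.2 + q) * W p σ (p.1, p.2 + q)) +
        ∑ p : FreqMomentum L M, ∑ σ : Fin 2, hard p * soft (p.1, p.2 + q) * W p σ (p.1, p.2 + q) := by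
    rw [← sum_add_distrib]
    refine sum_congr rfl fun p _ => ?_
    rw [← sum_add_distrib]
    refine sum_congr rfl fun σ _ => ?_
    ring
  -- reindex the first ordering onto the hard label
  have hA : (∑ p : FreqMomentum L M, ∑ σ : Fin 2, soft p * hard (p.1, p.2 + q) * W p σ (p.1, p.2 + q)) =
      ∑ p : FreqMomentum L M, ∑ σ : Fin 2, hard p * (soft (p.1, p.2 - q) * W (p.1, p.2 - q) σ p) := by
    rw [klph_sum_mshift_reindex q (fun p p' => ∑ σ : Fin 2, soft p * hard p' * W p σ p')]
    refine sum_congr rfl fun p _ => sum_congr rfl fun σ _ => ?_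
    ring
  rw [hsplit, hA, ← sum_add_distrib, ← sum_add_distrib]
  refine sum_congr rfl fun p _ => ?_
  rw [← sum_add_distrib, ← sum_add_distrib]
  refine sum_congr rfl fun σ _ => ?_
  ring

omit [NeZero M] in
/-- **The one-more-rung correction, sign-blind**, for ANY pair of shift maps `dn`, `up`: if `‖hard p‖ ≤ H`, `‖soft (dn p) − soft p‖, ‖soft (up p) − soft p‖ ≤ E`,
`‖W (dn p) σ p‖, ‖W p σ (up p)‖ ≤ F∞` wherever `hard p ≠ 0`, then
`‖Σ_pΣ_σ hard p·((soft (dn p) − soft p)·W (dn p) σ p + (soft (up p) − soft p)·W p σ (up p))‖ ≤ #{p : hard p ≠ 0}·(2·(H·(2E·F∞)))`. -/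
theorem klph_shift_corr_abstract_le (up dn : FreqMomentum L M → FreqMomentum L M) (hard soft : FreqMomentum L M → ℂ)
    (W : FreqMomentum L M → Fin 2 → FreqMomentum L M → ℂ) {H E Finf : ℝ} (hH0 : 0 ≤ H) (hE0 : 0 ≤ E)
    (hH : ∀ p, hard p ≠ 0 → ‖hard p‖ ≤ H)
    (hE : ∀ p, hard p ≠ 0 → ‖soft (dn p) - soft p‖ ≤ E ∧ ‖soft (up p) - soft p‖ ≤ E)
    (hF : ∀ p σ, hard p ≠ 0 → ‖W (dn p) σ p‖ ≤ Finf ∧ ‖W p σ (up p)‖ ≤ Finf) :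
    ‖∑ p : FreqMomentum L M, ∑ σ : Fin 2, hard p * ((soft (dn p) - soft p) * W (dn p) σ p + (soft (up p) - soft p) * W p σ (up p))‖ ≤
      ((univ.filter fun p : FreqMomentum L M => hard p ≠ 0).card : ℝ) * (2 * (H * (2 * E * Finf))) := by
  classical
  have hpt : ∀ p : FreqMomentum L M,
      ‖∑ σ : Fin 2, hard p * ((soft (dn p) - soft p) * W (dn p) σ p + (soft (up p) - soft p) * W p σ (up p))‖ ≤
        if hard p ≠ 0 then 2 * (H * (2 * E * Finf)) else 0 := by
    intro p
    by_cases hp : hard p = 0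
    · simp [hp]
    · rw [if_pos hp]
      have hσ : ∀ σ : Fin 2, ‖hard p * ((soft (dn p) - soft p) * W (dn p) σ p + (soft (up p) - soft p) * W p σ (up p))‖ ≤ H * (2 * E * Finf) := by
        intro σ
        rw [norm_mul]
        obtain ⟨hE1, hE2⟩ := hE p hp
        obtain ⟨hF1, hF2⟩ := hF p σ hp
        have h2 : ‖(soft (dn p) - soft p) * W (dn p) σ p + (soft (up p) - soft p) * W p σ (up p)‖ ≤ 2 * E * Finf := by
          refine (norm_add_le _ _).trans ?_
          rw [norm_mul, norm_mul]
          have := mul_le_mul hE1 hF1 (norm_nonneg _) hE0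
          have := mul_le_mul hE2 hF2 (norm_nonneg _) hE0
          linarith
        exact mul_le_mul (hH p hp) h2 (norm_nonneg _) hH0
      calc ‖∑ σ : Fin 2, hard p * ((soft (dn p) - soft p) * W (dn p) σ p + (soft (up p) - soft p) * W p σ (up p))‖
          ≤ ∑ σ : Fin 2, ‖hard p * ((soft (dn p) - soft p) * W (dn p) σ p + (soft (up p) - soft p) * W p σ (up p))‖ := norm_sum_le _ _
        _ ≤ ∑ _σ : Fin 2, H * (2 * E * Finf) := sum_le_sum fun σ _ => hσ σ
        _ = 2 * (H * (2 * E * Finf)) := by rw [sum_const, Finset.card_univ, Fintype.card_fin, nsmul_eq_mul, Nat.cast_ofNat]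
  calc ‖∑ p : FreqMomentum L M, ∑ σ : Fin 2, hard p * ((soft (dn p) - soft p) * W (dn p) σ p + (soft (up p) - soft p) * W p σ (up p))‖
      ≤ ∑ p : FreqMomentum L M, ‖∑ σ : Fin 2, hard p * ((soft (dn p) - soft p) * W (dn p) σ p + (soft (up p) - soft p) * W p σ (up p))‖ :=
        norm_sum_le _ _
    _ ≤ ∑ p : FreqMomentum L M, (if hard p ≠ 0 then 2 * (H * (2 * E * Finf)) else 0) := sum_le_sum fun p _ => hpt p
    _ = ((univ.filter fun p : FreqMomentum L M => hard p ≠ 0).card : ℝ) * (2 * (H * (2 * E * Finf))) := by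
        rw [← sum_filter, sum_const, nsmul_eq_mul]

end Transfer

end Summit.HubbardSuperconductivity.HubbardSuperconductivity.Theorems.KLRegimeSplit

end
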